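import Literature.Geometry.Lorentzian.StationaryOrbitRelation
import HarnessLib

/-!
# Sets compact modulo a flow: bounds for invariant functions and confinement by an equivariant
time function

Elementary geometry of the saturation `⋃ₜ θₜ(S)` (`stationaryOrbit X S`) of a COMPACT set `S` under
the flow `θ` of a complete vector field `X` — the form "compact modulo the stationary flow" in which
the cruxes of the summit `FinalStateConjecture` phrase compactness of slabs of the domain of outer
communications (Chruściel–Costa 2008, §4.2: `⟨⟨M_ext⟩⟩ ≈ ℝ × 𝒮₀`, with the flow acting by
translation on the `ℝ` factor and the time function `t` of Thm. 4.5 satisfying `t(φₛ p) = t(p) + s`).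

* `exists_bound_of_invariant_on_stationaryOrbit` — a function which is continuous on `S` and
  invariant under the flow is bounded on `⋃ₜ θₜ(S)`.
* `exists_isCompact_of_equivariant_time` — **confinement by Killing time**: if `t` is continuous on
  `S` and equivariant along the flow lines from `S` (`t(θ(s, a)) = t(a) + s`), then for every `C`
  the part `{y ∈ ⋃ₜ θₜ(S) | |t y| ≤ C}` lies in the compact set `θ([-τ₀, τ₀] × S)`,
  `τ₀ = C + max_S |t|`, itself contained in `⋃ₜ θₜ(S)`.

Used by the crux `NonTrappingHawkingRigidity` (stub `stub_farAxialSeed`): an orbit of the continued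
axial Killing field lies in a level set of `g(T,T)` compact modulo the stationary flow and its
Killing time grows at bounded rate, hence it stays in a compact set — the a priori bound feeding
`IsKillingFieldOn.exists_isMIntegralCurve_mem_of_apriori_isCompact`.

Everything here is proved; no definitions, no named facts.

## References
* P. T. Chruściel, J. L. Costa, Astérisque 321 (2008), arXiv:0806.0016, §4.2, Thm. 4.5. [ChruscielCosta2008]
* B. O'Neill, *Semi-Riemannian geometry*, Academic Press 1983, Ch. 1, Def. 1.52 ff. (flows). [ONeillSemiRiemannian1983]
-/

noncomputable section

open Set Filter Function TopologicalSpace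
open scoped Manifold ContDiff Topology

namespace Literature.Geometry.Lorentzian

variable {E : Type*} [NormedAddCommGroup E] [NormedSpace ℝ E] {H : Type*} [TopologicalSpace H]
  {I : ModelWithCorners ℝ E H} {M : Type*} [TopologicalSpace M] [ChartedSpace H M]
  [IsManifold I ∞ M] [T2Space M] [BoundarylessManifold I M]
  {X : Π x : M, TangentSpace I x} {θ : ℝ × M → M}

/-- **A flow-invariant function continuous on `S` is bounded on the saturation `⋃ₜ θₜ(S)` of a compact
`S`** (every point of the saturation is `θ(t, a)`, `a ∈ S`, where the function takes its value at `a`).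
[folklore] -/
theorem exists_bound_of_invariant_on_stationaryOrbit (hX : CMDiff 1 (T% X))
    (hθX : ∀ p, IsMIntegralCurve (fun t ↦ θ (t, p)) X) (hθ0 : ∀ p, θ (0, p) = p) {S : Set M}
    (hS : IsCompact S) {f : M → ℝ} (hf : ContinuousOn f S)
    (hinv : ∀ (t : ℝ), ∀ a ∈ S, f (θ (t, a)) = f a) :
    ∃ C : ℝ, ∀ y ∈ stationaryOrbit X S, |f y| ≤ C := by
  obtain ⟨C, hC⟩ := (hS.image_of_continuousOn hf).isBounded.subset_closedBall 0
  refine ⟨C, fun y hy ↦ ?_⟩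
  rw [stationaryOrbit_eq_iUnion_image_flow hX hθX hθ0] at hy
  obtain ⟨t, a, ha, rfl⟩ := by simpa only [mem_iUnion, mem_image] using hy
  rw [hinv t a ha]
  have h := hC (mem_image_of_mem f ha)
  simpa [Real.dist_eq] using h

/-- **Confinement by an equivariant time function.** Let `S` be compact, `θ` a continuous flow of the
`C¹` field `X`, and `t : M → ℝ` continuous on `S` with `t(θ(s, a)) = t(a) + s` for `a ∈ S` (Killing
time).  Then for every `C` there is a compact `K ⊆ ⋃ₜ θₜ(S)` containing every point `y` of the
saturation with `|t y| ≤ C`; indeed `K = θ([-τ₀, τ₀] × S)` with `τ₀ = C + max_S |t|`.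
Chruściel–Costa 2008, §4.2 (the flow is translation along the `ℝ` factor of `ℝ × 𝒮₀`).
[cite: ChruscielCosta2008, Thm. 4.5 (the flow of `K₀` is a translation along the `ℝ` factor)] -/
theorem exists_isCompact_of_equivariant_time (hX : CMDiff 1 (T% X))
    (hθX : ∀ p, IsMIntegralCurve (fun t ↦ θ (t, p)) X) (hθ0 : ∀ p, θ (0, p) = p)
    (hθc : Continuous θ) {S : Set M} (hS : IsCompact S) {t : M → ℝ} (ht : ContinuousOn t S)
    (hteq : ∀ (s : ℝ), ∀ a ∈ S, t (θ (s, a)) = t a + s) (C : ℝ) :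
    ∃ K : Set M, IsCompact K ∧ K ⊆ stationaryOrbit X S ∧
      ∀ y ∈ stationaryOrbit X S, |t y| ≤ C → y ∈ K := by
  obtain ⟨B, hB⟩ := (hS.image_of_continuousOn ht).isBounded.subset_closedBall 0
  have hBS : ∀ a ∈ S, |t a| ≤ B := fun a ha ↦ by
    have h := hB (mem_image_of_mem t ha)
    simpa [Real.dist_eq] using h
  set τ₀ : ℝ := C + B with hτ₀
  refine ⟨θ '' (Icc (-τ₀) τ₀ ×ˢ S), (isCompact_Icc.prod hS).image hθc, ?_, ?_⟩
  · rintro y ⟨⟨s, a⟩, ⟨-, ha⟩, rfl⟩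
    exact ⟨fun u ↦ θ (u, a), hθX a, by simpa [hθ0] using ha, s, rfl⟩
  · intro y hy hyC
    rw [stationaryOrbit_eq_iUnion_image_flow hX hθX hθ0] at hy
    obtain ⟨s, a, ha, rfl⟩ := by simpa only [mem_iUnion, mem_image] using hy
    refine ⟨(s, a), ⟨?_, ha⟩, rfl⟩
    have h1 : |t a + s| ≤ C := by rw [← hteq s a ha]; exact hyC
    have h2 : |t a| ≤ B := hBS a ha
    rw [mem_Icc]
    constructor
    · have := neg_abs_le (t a + s); have := le_abs_self (t a); rw [abs_le] at h1 h2; linarith [h1.1, h2.2]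
    · rw [abs_le] at h1 h2; linarith [h1.2, h2.1]

end Literature.Geometry.Lorentzian

end
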